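import Summits.BirchSwinnertonDyer.BirchSwinnertonDyer.Theorems.KolyvaginDepthDoorKolyvaginDepthSupplyAdmissibleData
import Summits.BirchSwinnertonDyer.BirchSwinnertonDyer.Theorems.KolyvaginDepthDoorDepthTableRowKitPrint
import Literature.NumberTheory.EllipticCurves.Wuthrich2014.ThreeAdicImageOrdinaryProofs
import HarnessLib

/-!
# Route `KolyvaginDepthDoor`, crux `KolyvaginDepthSupply` (stmt-BirchSwinnertonDyer-21765) —
# the witness data of the KN signed datum OTHER THAN THE BIT exist for every non-CM curve,
# UNCONDITIONALLY: an admissible prime on the Kodaira–Néron cell with the whole `p`-adic tower onto,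
# and a Heegner field

Helper file (`--supports stmt-BirchSwinnertonDyer-21765 --as helper`), route-independent (no `Theses`
import); it closes nothing and BSD is not proved by it.

The re-typing candidate `KolyvaginDepthSupplySignedDatumKN` (file `…KolyvaginDepthDoorDefs`, this seat)
asks of its witness prime `p` MORE than the filed crux: the whole tower `ρ̄_{E,p^n}` onto (not only
`ρ̄_{E,p}`) and the Kodaira–Néron side condition (KN_p) `p ∤ ord_v(Δ_min)` at every multiplicative place.
This file shows — as g2's `exists_admissiblePrime_heegnerField_of_not_hasCM` did for the filed crux —
that these extra conjuncts are NEVER the obstruction: for every non-CM globally minimal elliptic `E/ℚ`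
there are a prime `p ≥ 5` of good ordinary reduction with `ρ̄_{E,p^n}` onto for all `n`
(`forall_hasSurjectiveModNGaloisRep_pow_of_goodOrdinary_of_surj`: Serre IV-23 / Wuthrich at an
ordinary prime, a tree theorem) AND `p ∤ ord_v(Δ_min)` at every multiplicative `v` (take
`p > |Δ_min|`: `1 ≤ ord_v(Δ_min) < q^{ord_v(Δ_min)} ≤ |Δ_min| < p`), and an imaginary quadratic
Heegner field `K` for `N_E` with `d_K ∉ {−3, −4}` odd, `p ∤ d_K N_E` (g2: Serre's open image theorem +
infinitely many ordinary primes + Dirichlet, all discharged). So the open content of the KN signed datum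
is the bit and its rank clause alone («`Ш(E/ℚ)[p] = 0` at an admissible Kodaira–Néron prime»).

* `not_dvd_ordMinimalDiscriminant_of_natAbs_lt` — (KN_p) for every `p > |Δ_min|`, unconditional.
* `exists_admissiblePrime_kodairaNeron_heegnerField_of_not_hasCM` — the witness data minus the bit.

References: [SerreAbelianLadic1968] IV-23 Lemma 3; [Wuthrich2014] Lemma 20; [Serre1972] §4.2 Thm. 2;
[Gross1984] §3; [SilvermanAEC2009] VII.5.1, VIII.8.
-/

set_option linter.dupNamespace false

noncomputable section

open scoped Classical NumberField

namespace Summit.BirchSwinnertonDyer.BirchSwinnertonDyer.Theorems.KolyvaginDepthDoor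

open Literature.NumberTheory.EllipticCurves Literature.NumberTheory.EllipticCurves.ModularForms
  WeierstrassCurve NumberField IsDedekindDomain

/-- **(KN_p) above the minimal discriminant, unconditional**: for `W/ℚ` globally minimal elliptic and
any natural number `p > |Δ_min|`, `p ∤ ord_v(Δ_min)` at every place `v` of multiplicative reduction:
there `1 ≤ ord_v(Δ_min) = v_q(Δ_min) < q^{v_q(Δ_min)} ≤ |Δ_min| < p`
(`ordMinimalDiscriminant_eq_padicValInt_natGenerator_ringOfIntegers`). [cite: SilvermanAEC2009, VII.5.1 and VIII.8] -/
theorem not_dvd_ordMinimalDiscriminant_of_natAbs_lt (W : WeierstrassCurve ℚ) [W.IsElliptic]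
    [W.IsGloballyMinimal] {p : ℕ} (hp : W.minimalDiscriminantInt.natAbs < p)
    (v : HeightOneSpectrum (𝓞 ℚ)) (hv : W.HasMultiplicativeReductionAt v) :
    ¬ p ∣ W.ordMinimalDiscriminant v := by
  set q := Rat.HeightOneSpectrum.natGenerator v with hq
  have hqP : q.Prime := Rat.HeightOneSpectrum.prime_natGenerator v
  haveI : Fact q.Prime := ⟨hqP⟩
  set n := W.minimalDiscriminantInt.natAbs with hn
  have hord : W.ordMinimalDiscriminant v = padicValNat q n := by
    rw [ordMinimalDiscriminant_eq_padicValInt_natGenerator_ringOfIntegers v, padicValInt]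
  have hne : W.ordMinimalDiscriminant v ≠ 0 := fun h0 ↦
    hv.not_hasGoodReductionAt ((W.ordMinimalDiscriminant_eq_zero_iff_holds v).mp h0)
  rw [hord] at hne ⊢
  have hn0 : n ≠ 0 := by
    intro h0
    rw [h0, padicValNat_zero_right] at hne
    exact hne rfl
  have hk1 : 1 ≤ padicValNat q n := Nat.one_le_iff_ne_zero.mpr hne
  have hle : q ^ padicValNat q n ≤ n := Nat.le_of_dvd (Nat.pos_of_ne_zero hn0) pow_padicValNat_dvd
  have hlt : padicValNat q n < q ^ padicValNat q n := Nat.lt_pow_self hqP.one_lt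
  intro hdvd
  have := Nat.le_of_dvd hk1 hdvd
  omega

/-- **The witness data of `KolyvaginDepthSupplySignedDatumKN` other than the bit exist, unconditionally.**
For every non-CM globally minimal elliptic `E/ℚ` there are a prime `p ≥ 5` of good ORDINARY reduction
with `ρ̄_{E,p^n}` SURJECTIVE FOR ALL `n` and the Kodaira–Néron side condition `p ∤ ord_v(Δ_min)` at
every multiplicative place, and an imaginary quadratic field `K` with `d_K ≠ −3`, `d_K ≠ −4`, `d_K`
odd, `p ∤ d_K`, `p ∤ N_E`, `N_E ≠ 0`, the Heegner hypothesis for `N_E` and for `p`. Proof: g2's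
`exists_admissiblePrime_heegnerField_gt_of_not_hasCM` above the bound `|Δ_min|` (Serre's open image
theorem, infinitely many good ordinary primes, Dirichlet — all tree theorems), the tower from
`forall_hasSurjectiveModNGaloisRep_pow_of_goodOrdinary_of_surj` (Serre IV-23 / Wuthrich Lemma 20 at an
ordinary prime, tree theorem), (KN_p) from `not_dvd_ordMinimalDiscriminant_of_natAbs_lt`. Hence the
(KN) and tower conjuncts of the re-typing candidate are free: its open content is the bit with its rank
clause. Unconditional; BSD is not proved by it. [cite: Serre1972, §4.2 Thm. 2]
[cite: SerreAbelianLadic1968, Ch. IV §3.4 Lemma 3] [cite: Wuthrich2014, Lemma 20] [cite: Gross1984, §3] -/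
theorem exists_admissiblePrime_kodairaNeron_heegnerField_of_not_hasCM (W : WeierstrassCurve ℚ)
    [W.IsElliptic] [W.IsGloballyMinimal] (hW : ¬ W.HasCM) :
    ∃ (p : ℕ) (_ : Fact p.Prime), 5 ≤ p ∧ W.HasGoodReductionAtPrime p ∧
      ¬ (p : ℤ) ∣ W.frobeniusTrace p ∧ (∀ n : ℕ, W.HasSurjectiveModNGaloisRep (p ^ n : ℕ)) ∧
      (∀ v : HeightOneSpectrum (𝓞 ℚ), W.HasMultiplicativeReductionAt v →
        ¬ p ∣ W.ordMinimalDiscriminant v) ∧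
      ∃ (K : Type) (_ : Field K) (_ : NumberField K), IsImaginaryQuadratic K ∧
        NumberField.discr K ≠ -3 ∧ NumberField.discr K ≠ -4 ∧
        ¬ ((p : ℤ) ∣ NumberField.discr K) ∧ ¬ (p ∣ W.conductorNorm ℤ) ∧
        ∃ (_ : NeZero (W.conductorNorm ℤ)),
          SatisfiesHeegnerHypothesis (W.conductorNorm ℤ) K ∧
          Odd (NumberField.discr K) ∧ SatisfiesHeegnerHypothesis p K := by
  obtain ⟨p, hp, hB, h5, hgood, hord, hsurj, K, iF, iN, hK, hne3, hne4, hnp, hpN, hNZ, hHN, hodd, -,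
    hHp⟩ := exists_admissiblePrime_heegnerField_gt_of_not_hasCM W hW W.minimalDiscriminantInt.natAbs
  haveI := hp
  have hp2 : p ≠ 2 := by omega
  exact ⟨p, hp, h5, hgood, hord,
    WeierstrassCurve.forall_hasSurjectiveModNGaloisRep_pow_of_goodOrdinary_of_surj W p hp2 hgood hord
      hsurj,
    not_dvd_ordMinimalDiscriminant_of_natAbs_lt W hB, K, iF, iN, hK, hne3, hne4, hnp, hpN, hNZ, hHN,
    hodd, hHp⟩

end Summit.BirchSwinnertonDyer.BirchSwinnertonDyer.Theorems.KolyvaginDepthDoor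

end
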